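import Literature.NumberTheory.Weil1982.UnitaryFinCayleyWindow          -- ★ (J2α): generic `cayley`, `cayley_def`, `cayley_sub_one`, `cayley_neg_mul_cayley_sub_one`, `one_sub_inv_mul_one_add`
import Literature.NumberTheory.Automorphic.GLnCongruenceSubgroups       -- ★ `ValBound` algebra, `isUnit_det_and_valBound_inv`
import HarnessLib

/-!
# The Cayley product sandwich: `c(W)·c(X) = c(W + X + (second order))`, entrywise, over a valued field

Topic `NumberTheory/Weil1982`; namespace `Literature.NumberTheory.Weil1982.UnitaryFinTopForm` (continues the generic Cayley algebra of ★ (J2α)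
`UnitaryFinCayleyWindow` §3).  THEOREMS ONLY (no definition ∕ instance ∕ notation ∕ named fact ∕ `sorry`); Mathlib + ★ `UnitaryFinCayleyWindow` + ★
`GLnCongruenceSubgroups` (`ValBound γ M` = every entry of `M` has valuation `≤ γ`).  Cell `pub/hodgecm-mathlib`, crux H413 = `stmt-HodgeConjecture-24833`,
WIF antecedent of RUNG0, ELLIPTIC half via the Cayley window (offer «JAC-ELL», LH5-p02 (g6), bus F0∕P3b 2026-09-02T14:29Z): brick (C2).  Count-neutral.

THE MATHEMATICS (the group law of a standard group in its chart is `X + Y +` (terms of degree `≥ 2`) — [Serre1992LALG] Part II Ch. IV §8 «standard groups»;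
the Cayley chart of [PlatonovRapinchuk1994] §3.3).  For square matrices `W, X` over a commutative ring with `1 − W`, `1 − X`, `1 + WX` invertible,

  `c(W) · c(X) = c(S)`,   `S := (1 − W)⁻¹ (W + X) (1 + W X)⁻¹ (1 − W)`,   `c(X) = (1 + X)(1 − X)⁻¹`        (`cayley_mul_cayley_eq_cayley`)

(because `1 ± S = (1 − W)⁻¹ ((1 + WX) ± (W + X)) (1 + WX)⁻¹ (1 − W)` and `(1 + WX) + (W + X) = (1 + W)(1 + X)`, `(1 + WX) − (W + X) = (1 − W)(1 − X)`).
Over a field with a valuation, if the entries of `W` are `≤ α < 1` and those of `X` are `≤ β < 1` (so all these matrices ARE invertible over the valuation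
ring, ★ `isUnit_det_and_valBound_inv`), then ENTRYWISE

  `S − (W + X)` is `≤ α β`  (`valBound_cayleySandwich_sub_add`),   `S` is `≤ max α β`,   `S|_{X = 0} = W`,
  `S(X + Y) − S(X) − Y` is `≤ α γ` for `Y ≤ γ ≤ β`  (`valBound_cayleySandwich_incr` — the FILTERED NEWTON HYPOTHESIS `(N)` of ★ (C1)
  `F0P3cStCharTSFilteredNewton` for the chart map `X ↦ S(W, X)` of left multiplication by `c(W)`, one level gained as soon as `α ≤ |ϖ|`),

from the two exact identities `S − (W + X) = (1 − W)⁻¹ ( WX − XW + (W + X)((1 + WX)⁻¹ − 1)(1 − W) )` and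
`(1 + W(X+Y))⁻¹ − (1 + WX)⁻¹ = −(1 + W(X+Y))⁻¹ · WY · (1 + WX)⁻¹`.  Finally `c` is INJECTIVE on the ball `{X ≤ α}`, `α < 1`, when `2 ≠ 0`
(`eq_of_cayley_eq_cayley`, from ★ `cayley_neg_mul_cayley_sub_one`), and `c(X) + 1 = 2·(1 − X)⁻¹` (`cayley_add_one`).
HONEST LABEL: HC_CM is proved only modulo the 7 printed citations (2 remaining named inputs: hLiu418 = `stmt-HodgeConjecture-24832`, h413 =
`stmt-HodgeConjecture-24833`) until rung 0 closes; this file closes no organ.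

## References
* [Serre1992LALG] J.-P. Serre, *Lie Algebras and Lie Groups*, LNM 1500 (1992), Part II Ch. IV §8 (standard groups: the group law is `X + Y + O(2)`).
* [PlatonovRapinchuk1994] V. Platonov, A. Rapinchuk, *Algebraic Groups and Number Theory* (1994), §3.3 (congruence subgroups via the Cayley map).
-/

set_option autoImplicit false

open Matrix ValuativeRel Literature.NumberTheory.Automorphic
open scoped Matrix

namespace Literature.NumberTheory.Weil1982.UnitaryFinTopForm

/-! ## §1 The product formula over a commutative ring -/

section Ring

variable {R : Type*} [CommRing R] {n : Type*} [Fintype n] [DecidableEq n]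

/-- `(1 + WX) + (W + X) = (1 + W)(1 + X)`. [cite: Serre1992LALG, Part II Ch. IV §8] -/
theorem one_add_mul_add_add (W X : Matrix n n R) : (1 + W * X) + (W + X) = (1 + W) * (1 + X) := by noncomm_ring

/-- `(1 + WX) − (W + X) = (1 − W)(1 − X)`. [cite: Serre1992LALG, Part II Ch. IV §8] -/
theorem one_add_mul_sub_add (W X : Matrix n n R) : (1 + W * X) - (W + X) = (1 - W) * (1 - X) := by noncomm_ring

/-- `1 ± S` for the sandwich `S = P⁻¹ A B⁻¹ P`: `1 + S = P⁻¹ (B + A) B⁻¹ P` and `1 − S = P⁻¹ (B − A) B⁻¹ P` (`P`, `B` invertible).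
[cite: Serre1992LALG, Part II Ch. IV §8] -/
theorem one_add_sandwich_eq {P A B : Matrix n n R} (hP : IsUnit P.det) (hB : IsUnit B.det) :
    1 + P⁻¹ * A * B⁻¹ * P = P⁻¹ * (B + A) * B⁻¹ * P ∧ 1 - P⁻¹ * A * B⁻¹ * P = P⁻¹ * (B - A) * B⁻¹ * P := by
  have hPP : P⁻¹ * P = 1 := Matrix.nonsing_inv_mul _ hP
  have hBB : B * B⁻¹ = 1 := Matrix.mul_nonsing_inv _ hB
  have h1 : (1 : Matrix n n R) = P⁻¹ * B * B⁻¹ * P := by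
    rw [Matrix.mul_assoc P⁻¹, hBB, Matrix.mul_one, hPP]
  constructor
  · conv_lhs => rw [h1]
    noncomm_ring
  · conv_lhs => rw [h1]
    noncomm_ring

/-- **THE CAYLEY PRODUCT FORMULA**: `c(W)·c(X) = c((1 − W)⁻¹ (W + X) (1 + WX)⁻¹ (1 − W))` whenever `1 − W`, `1 − X` and `1 + WX` are invertible.
[cite: Serre1992LALG, Part II Ch. IV §8] [cite: PlatonovRapinchuk1994, §3.3] -/
theorem cayley_mul_cayley_eq_cayley {W X : Matrix n n R} (hW : IsUnit (1 - W).det) (hX : IsUnit (1 - X).det)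
    (hB : IsUnit (1 + W * X).det) :
    cayley W * cayley X = cayley ((1 - W)⁻¹ * (W + X) * (1 + W * X)⁻¹ * (1 - W)) := by
  set P : Matrix n n R := 1 - W with hPdef
  set B : Matrix n n R := 1 + W * X with hBdef
  obtain ⟨hplus, hminus⟩ := one_add_sandwich_eq (A := W + X) hW hB
  have hPP : P * P⁻¹ = 1 := Matrix.mul_nonsing_inv _ hW
  have hPP' : P⁻¹ * P = 1 := Matrix.nonsing_inv_mul _ hW
  have hBB : B⁻¹ * B = 1 := Matrix.nonsing_inv_mul _ hB
  -- `B + A = (1 + W)(1 + X)`, `B − A = P (1 − X)`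
  have hBA : B + (W + X) = (1 + W) * (1 + X) := one_add_mul_add_add W X
  have hBA' : B - (W + X) = P * (1 - X) := one_add_mul_sub_add W X
  -- `1 − S` is invertible
  have hmdet : IsUnit (1 - P⁻¹ * (W + X) * B⁻¹ * P).det := by
    rw [hminus, hBA', Matrix.det_mul, Matrix.det_mul, Matrix.det_mul, Matrix.det_mul]
    exact (((Matrix.isUnit_nonsing_inv_det _ hW).mul (hW.mul hX)).mul (Matrix.isUnit_nonsing_inv_det _ hB)).mul hW
  -- `c(W) = P⁻¹ (1 + W)`
  have hcW : cayley W = P⁻¹ * (1 + W) := by rw [cayley_def, one_sub_inv_mul_one_add hW]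
  -- the key identity `c(W) c(X) (1 − S) = 1 + S`
  have key : cayley W * cayley X * (1 - P⁻¹ * (W + X) * B⁻¹ * P) = 1 + P⁻¹ * (W + X) * B⁻¹ * P := by
    rw [hminus, hplus, hBA', hBA, hcW]
    calc P⁻¹ * (1 + W) * cayley X * (P⁻¹ * (P * (1 - X)) * B⁻¹ * P)
        = P⁻¹ * (1 + W) * (cayley X * ((P⁻¹ * P) * (1 - X))) * B⁻¹ * P := by simp only [Matrix.mul_assoc]
      _ = P⁻¹ * (1 + W) * (1 + X) * B⁻¹ * P := by rw [hPP', Matrix.one_mul, cayley_mul_one_sub hX, Matrix.mul_assoc P⁻¹]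
      _ = P⁻¹ * ((1 + W) * (1 + X)) * B⁻¹ * P := by simp only [Matrix.mul_assoc]
  calc cayley W * cayley X
      = cayley W * cayley X * ((1 - P⁻¹ * (W + X) * B⁻¹ * P) * (1 - P⁻¹ * (W + X) * B⁻¹ * P)⁻¹) := by
        rw [Matrix.mul_nonsing_inv _ hmdet, Matrix.mul_one]
    _ = (1 + P⁻¹ * (W + X) * B⁻¹ * P) * (1 - P⁻¹ * (W + X) * B⁻¹ * P)⁻¹ := by rw [← Matrix.mul_assoc, key]
    _ = cayley (P⁻¹ * (W + X) * B⁻¹ * P) := (cayley_def _).symm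

/-- Invertibility of `1 − S`: `det (1 − S)` is a unit (`1 − S = (1 − W)⁻¹ (1 − W)(1 − X)(1 + WX)⁻¹ (1 − W)`). [cite: Serre1992LALG, Part II Ch. IV §8] -/
theorem isUnit_det_one_sub_cayleySandwich {W X : Matrix n n R} (hW : IsUnit (1 - W).det) (hX : IsUnit (1 - X).det)
    (hB : IsUnit (1 + W * X).det) :
    IsUnit (1 - (1 - W)⁻¹ * (W + X) * (1 + W * X)⁻¹ * (1 - W)).det := by
  obtain ⟨-, hminus⟩ := one_add_sandwich_eq (A := W + X) hW hB
  rw [hminus, one_add_mul_sub_add, Matrix.det_mul, Matrix.det_mul, Matrix.det_mul, Matrix.det_mul]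
  exact (((Matrix.isUnit_nonsing_inv_det _ hW).mul (hW.mul hX)).mul (Matrix.isUnit_nonsing_inv_det _ hB)).mul hW

/-- At `X = 0` the sandwich is `W` itself: `(1 − W)⁻¹ · W · 1⁻¹ · (1 − W) = W`. [cite: Serre1992LALG, Part II Ch. IV §8] -/
theorem cayleySandwich_zero {W : Matrix n n R} (hW : IsUnit (1 - W).det) :
    (1 - W)⁻¹ * (W + 0) * (1 + W * 0)⁻¹ * (1 - W) = W := by
  have hc : W * (1 - W) = (1 - W) * W := by noncomm_ring
  rw [add_zero, Matrix.mul_zero, add_zero, inv_one, Matrix.mul_one, Matrix.mul_assoc, hc, ← Matrix.mul_assoc,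
    Matrix.nonsing_inv_mul _ hW, Matrix.one_mul]

/-- **The exact second-order remainder**: `S − (W + X) = (1 − W)⁻¹ ( (WX − XW) + (W + X)((1 + WX)⁻¹ − 1)(1 − W) )`.
[cite: Serre1992LALG, Part II Ch. IV §8] -/
theorem cayleySandwich_sub_add_eq {W X : Matrix n n R} (hW : IsUnit (1 - W).det) :
    (1 - W)⁻¹ * (W + X) * (1 + W * X)⁻¹ * (1 - W) - (W + X)
      = (1 - W)⁻¹ * ((W * X - X * W) + (W + X) * ((1 + W * X)⁻¹ - 1) * (1 - W)) := by
  have hPP : (1 - W)⁻¹ * (1 - W) = 1 := Matrix.nonsing_inv_mul _ hW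
  have h : (1 - W)⁻¹ * ((W * X - X * W) + (W + X) * ((1 + W * X)⁻¹ - 1) * (1 - W))
      = (1 - W)⁻¹ * (W + X) * (1 + W * X)⁻¹ * (1 - W) - ((1 - W)⁻¹ * (1 - W)) * (W + X) := by noncomm_ring
  rw [h, hPP, Matrix.one_mul]

/-- **The exact resolvent identity** `(1 + W(X + Y))⁻¹ − (1 + WX)⁻¹ = −(1 + W(X + Y))⁻¹ · WY · (1 + WX)⁻¹`. [cite: Serre1992LALG, Part II Ch. IV §8] -/
theorem inv_one_add_mul_add_sub_inv {W X Y : Matrix n n R} (hB : IsUnit (1 + W * X).det) (hB' : IsUnit (1 + W * (X + Y)).det) :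
    (1 + W * (X + Y))⁻¹ - (1 + W * X)⁻¹ = -((1 + W * (X + Y))⁻¹ * (W * Y) * (1 + W * X)⁻¹) := by
  have h1 : (1 + W * (X + Y))⁻¹ * (1 + W * (X + Y)) = 1 := Matrix.nonsing_inv_mul _ hB'
  have h2 : (1 + W * X) * (1 + W * X)⁻¹ = 1 := Matrix.mul_nonsing_inv _ hB
  have hd : (1 + W * (X + Y)) - (1 + W * X) = W * Y := by noncomm_ring
  calc (1 + W * (X + Y))⁻¹ - (1 + W * X)⁻¹
      = (1 + W * (X + Y))⁻¹ * ((1 + W * X) * (1 + W * X)⁻¹) - ((1 + W * (X + Y))⁻¹ * (1 + W * (X + Y))) * (1 + W * X)⁻¹ := by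
        rw [h1, h2, Matrix.mul_one, Matrix.one_mul]
    _ = -((1 + W * (X + Y))⁻¹ * ((1 + W * (X + Y)) - (1 + W * X)) * (1 + W * X)⁻¹) := by noncomm_ring
    _ = -((1 + W * (X + Y))⁻¹ * (W * Y) * (1 + W * X)⁻¹) := by rw [hd]

/-- **The exact increment of the remainder**: with `R(X) := S(X) − (W + X)`,
`R(X + Y) − R(X) = (1 − W)⁻¹ ( (WY − YW) + Y((1 + W(X+Y))⁻¹ − 1)(1 − W) + (W + X)((1 + W(X+Y))⁻¹ − (1 + WX)⁻¹)(1 − W) )`. [cite: Serre1992LALG, Part II Ch. IV §8] -/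
theorem cayleySandwich_incr_eq {W X Y : Matrix n n R} (hW : IsUnit (1 - W).det) :
    ((1 - W)⁻¹ * (W + (X + Y)) * (1 + W * (X + Y))⁻¹ * (1 - W)) - ((1 - W)⁻¹ * (W + X) * (1 + W * X)⁻¹ * (1 - W)) - Y
      = (1 - W)⁻¹ * ((W * Y - Y * W) + Y * ((1 + W * (X + Y))⁻¹ - 1) * (1 - W)
          + (W + X) * ((1 + W * (X + Y))⁻¹ - (1 + W * X)⁻¹) * (1 - W)) := by
  have e1 := cayleySandwich_sub_add_eq (X := X + Y) hW
  have e2 := cayleySandwich_sub_add_eq (X := X) hW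
  have h : ((1 - W)⁻¹ * (W + (X + Y)) * (1 + W * (X + Y))⁻¹ * (1 - W)) - ((1 - W)⁻¹ * (W + X) * (1 + W * X)⁻¹ * (1 - W)) - Y
      = ((1 - W)⁻¹ * (W + (X + Y)) * (1 + W * (X + Y))⁻¹ * (1 - W) - (W + (X + Y)))
        - ((1 - W)⁻¹ * (W + X) * (1 + W * X)⁻¹ * (1 - W) - (W + X)) := by noncomm_ring
  rw [h, e1, e2, ← Matrix.mul_sub]
  congr 1
  noncomm_ring

end Ring

/-! ## §2 Entrywise bounds over a valued field -/

section Valued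

variable {F : Type*} [Field F] [ValuativeRel F] {m : Type*} [Fintype m] [DecidableEq m]

/-- `1 − W` has unit determinant, integral inverse, and `(1 − W)⁻¹ ≡ 1` within `α`, when the entries of `W` are `≤ α < 1`.
[cite: PlatonovRapinchuk1994, §3.3] -/
theorem isUnit_det_one_sub_of_valBound {α : ValueGroupWithZero F} {W : Matrix m m F} (hW : ValBound α W) (hα : α < 1) :
    IsUnit (1 - W).det ∧ ValBound 1 (1 - W)⁻¹ ∧ ValBound α ((1 - W)⁻¹ - 1) := by
  refine isUnit_det_and_valBound_inv (γ := α) ?_ hα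
  rw [sub_sub_cancel_left]
  exact hW.neg

/-- `1 + W` has unit determinant, integral inverse, and `(1 + W)⁻¹ ≡ 1` within `α`, when the entries of `W` are `≤ α < 1`.
[cite: PlatonovRapinchuk1994, §3.3] -/
theorem isUnit_det_one_add_of_valBound {α : ValueGroupWithZero F} {W : Matrix m m F} (hW : ValBound α W) (hα : α < 1) :
    IsUnit (1 + W).det ∧ ValBound 1 (1 + W)⁻¹ ∧ ValBound α ((1 + W)⁻¹ - 1) := by
  refine isUnit_det_and_valBound_inv (γ := α) ?_ hα
  rw [add_sub_cancel_left]
  exact hW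

/-- `1 + WX` has unit determinant, integral inverse, and `(1 + WX)⁻¹ ≡ 1` within `αβ`, when `W ≤ α < 1`, `X ≤ β ≤ 1` entrywise.
[cite: PlatonovRapinchuk1994, §3.3] -/
theorem isUnit_det_one_add_mul_of_valBound {α β : ValueGroupWithZero F} {W X : Matrix m m F} (hW : ValBound α W) (hX : ValBound β X)
    (hα : α < 1) (hβ : β ≤ 1) :
    IsUnit (1 + W * X).det ∧ ValBound 1 (1 + W * X)⁻¹ ∧ ValBound (α * β) ((1 + W * X)⁻¹ - 1) := by
  refine isUnit_det_and_valBound_inv (γ := α * β) ?_ ?_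
  · rw [add_sub_cancel_left]; exact hW.mul hX
  · calc α * β ≤ α * 1 := mul_le_mul' le_rfl hβ
      _ < 1 := by rwa [mul_one]

omit [Fintype m] in
/-- The `1 − W` side is integral: `ValBound 1 (1 − W)` for `W ≤ α ≤ 1`. [cite: PlatonovRapinchuk1994, §3.3] -/
theorem valBound_one_one_sub {α : ValueGroupWithZero F} {W : Matrix m m F} (hW : ValBound α W) (hα : α ≤ 1) : ValBound 1 (1 - W) :=
  valBound_one.sub (hW.mono hα)

/-- **SECOND ORDER**: the entries of `S − (W + X)` are `≤ αβ` (`W ≤ α < 1`, `X ≤ β < 1`). [cite: Serre1992LALG, Part II Ch. IV §8] -/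
theorem valBound_cayleySandwich_sub_add {α β : ValueGroupWithZero F} {W X : Matrix m m F} (hW : ValBound α W) (hX : ValBound β X)
    (hα : α < 1) (hβ : β < 1) :
    ValBound (α * β) ((1 - W)⁻¹ * (W + X) * (1 + W * X)⁻¹ * (1 - W) - (W + X)) := by
  obtain ⟨hWu, hPinv, -⟩ := isUnit_det_one_sub_of_valBound hW hα
  obtain ⟨-, -, hE⟩ := isUnit_det_one_add_mul_of_valBound hW hX hα hβ.le
  rw [cayleySandwich_sub_add_eq hWu]
  have hmax : ValBound 1 (W + X) := (hW.mono hα.le).add (hX.mono hβ.le)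
  have h1 : ValBound (α * β) (W * X - X * W) := (hW.mul hX).sub (by simpa [mul_comm] using hX.mul hW)
  have h2 : ValBound (α * β) ((W + X) * ((1 + W * X)⁻¹ - 1) * (1 - W)) := by
    have := (hmax.mul hE).mul (valBound_one_one_sub hW hα.le)
    simpa using this
  simpa using hPinv.mul (h1.add h2)

/-- The entries of `S` itself are `≤ max α β`. [cite: Serre1992LALG, Part II Ch. IV §8] -/
theorem valBound_cayleySandwich {α β : ValueGroupWithZero F} {W X : Matrix m m F} (hW : ValBound α W) (hX : ValBound β X)
    (hα : α < 1) (hβ : β < 1) :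
    ValBound (max α β) ((1 - W)⁻¹ * (W + X) * (1 + W * X)⁻¹ * (1 - W)) := by
  have h := valBound_cayleySandwich_sub_add hW hX hα hβ
  have hWX : ValBound (max α β) (W + X) := (hW.mono (le_max_left _ _)).add (hX.mono (le_max_right _ _))
  have hαβ : α * β ≤ max α β :=
    calc α * β ≤ α * 1 := mul_le_mul' le_rfl hβ.le
      _ = α := mul_one α
      _ ≤ max α β := le_max_left _ _
  have : (1 - W)⁻¹ * (W + X) * (1 + W * X)⁻¹ * (1 - W)
      = ((1 - W)⁻¹ * (W + X) * (1 + W * X)⁻¹ * (1 - W) - (W + X)) + (W + X) := by abel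
  rw [this]
  exact (h.mono hαβ).add hWX

/-- **THE FILTERED NEWTON HYPOTHESIS FOR THE CHART OF LEFT MULTIPLICATION**: the entries of `S(X + Y) − S(X) − Y` are `≤ αγ` for
`W ≤ α < 1`, `X ≤ β < 1`, `Y ≤ γ ≤ β` (one level gained as soon as `α` is one level below `1`). [cite: Serre1992LALG, Part II Ch. IV §8] -/
theorem valBound_cayleySandwich_incr {α β γ : ValueGroupWithZero F} {W X Y : Matrix m m F} (hW : ValBound α W) (hX : ValBound β X)
    (hY : ValBound γ Y) (hα : α < 1) (hβ : β < 1) (hγ : γ ≤ β) :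
    ValBound (α * γ) (((1 - W)⁻¹ * (W + (X + Y)) * (1 + W * (X + Y))⁻¹ * (1 - W))
      - ((1 - W)⁻¹ * (W + X) * (1 + W * X)⁻¹ * (1 - W)) - Y) := by
  obtain ⟨hWu, hPinv, -⟩ := isUnit_det_one_sub_of_valBound hW hα
  have hXY : ValBound β (X + Y) := hX.add (hY.mono hγ)
  obtain ⟨hBu, hBinv, -⟩ := isUnit_det_one_add_mul_of_valBound hW hX hα hβ.le
  obtain ⟨hB'u, hB'inv, hE'⟩ := isUnit_det_one_add_mul_of_valBound hW hXY hα hβ.le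
  rw [cayleySandwich_incr_eq hWu]
  have hP1 : ValBound 1 (1 - W) := valBound_one_one_sub hW hα.le
  have hWX1 : ValBound 1 (W + X) := (hW.mono hα.le).add (hX.mono hβ.le)
  -- the three terms
  have h1 : ValBound (α * γ) (W * Y - Y * W) := (hW.mul hY).sub (by simpa [mul_comm] using hY.mul hW)
  have h2 : ValBound (α * γ) (Y * ((1 + W * (X + Y))⁻¹ - 1) * (1 - W)) := by
    have := (hY.mul hE').mul hP1
    refine (by simpa using this : ValBound (γ * (α * β)) _).mono ?_
    calc γ * (α * β) = α * γ * β := by rw [mul_left_comm, ← mul_assoc]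
      _ ≤ α * γ * 1 := mul_le_mul' le_rfl hβ.le
      _ = α * γ := mul_one _
  have h3 : ValBound (α * γ) ((W + X) * ((1 + W * (X + Y))⁻¹ - (1 + W * X)⁻¹) * (1 - W)) := by
    rw [inv_one_add_mul_add_sub_inv hBu hB'u]
    have hin : ValBound (α * γ) ((1 + W * (X + Y))⁻¹ * (W * Y) * (1 + W * X)⁻¹) := by
      simpa using (hB'inv.mul (hW.mul hY)).mul hBinv
    simpa using (hWX1.mul hin.neg).mul hP1
  simpa using hPinv.mul ((h1.add h2).add h3)

/-! ## §3 Injectivity of the Cayley window on the ball and the inverse formula -/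

/-- `c(X) + 1 = 2·(1 − X)⁻¹` (so `c(X) + 1` is invertible exactly when `2` is). [cite: PlatonovRapinchuk1994, §3.3] -/
theorem cayley_add_one {R : Type*} [CommRing R] {n : Type*} [Fintype n] [DecidableEq n] {X : Matrix n n R}
    (hm : IsUnit (1 - X).det) : cayley X + 1 = (2 : R) • (1 - X)⁻¹ := by
  have h := cayley_sub_one hm
  have h1 : (1 - X) * (1 - X)⁻¹ = 1 := Matrix.mul_nonsing_inv _ hm
  calc cayley X + 1 = (cayley X - 1) + (2 : R) • ((1 - X) * (1 - X)⁻¹) := by rw [h1, two_smul]; abel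
    _ = (2 : R) • (X * (1 - X)⁻¹) + (2 : R) • ((1 - X) * (1 - X)⁻¹) := by rw [h]
    _ = (2 : R) • (1 - X)⁻¹ := by rw [← smul_add, ← Matrix.add_mul, add_sub_cancel, Matrix.one_mul]

/-- **INJECTIVITY OF THE CAYLEY WINDOW ON THE BALL**: if `2 ≠ 0` in `F` and `X, X′` have entries `≤ α < 1`, then `c(X) = c(X′) ⇒ X = X′`
(`c(−X)c(X′) − 1 = 2(1+X)⁻¹(X′ − X)(1 − X′)⁻¹` vanishes, and the outer factors are units). [cite: PlatonovRapinchuk1994, §3.3] -/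
theorem eq_of_cayley_eq_cayley (h2 : (2 : F) ≠ 0) {α : ValueGroupWithZero F} {X X' : Matrix m m F} (hX : ValBound α X)
    (hX' : ValBound α X') (hα : α < 1) (h : cayley X = cayley X') : X = X' := by
  obtain ⟨hmX, -, -⟩ := isUnit_det_one_sub_of_valBound hX hα
  obtain ⟨hpX, -, -⟩ := isUnit_det_one_add_of_valBound hX hα
  obtain ⟨hmX', -, -⟩ := isUnit_det_one_sub_of_valBound hX' hα
  have key := cayley_neg_mul_cayley_sub_one (X := X) (Y := X') hpX hmX'
  rw [← h, cayley_neg_mul_cayley hmX hpX, sub_self] at key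
  -- cancel the scalar `2` and the two unit factors
  have hz : (1 + X)⁻¹ * (X' - X) * (1 - X')⁻¹ = 0 := by
    have := congrArg (fun M => ((2 : F)⁻¹) • M) key
    simpa [smul_smul, inv_mul_cancel₀ h2] using this.symm
  have h3 : X' - X = 0 := by
    calc X' - X = (1 + X) * ((1 + X)⁻¹ * (X' - X) * (1 - X')⁻¹) * (1 - X') := by
          rw [Matrix.mul_assoc (1 + X)⁻¹, ← Matrix.mul_assoc (1 + X), Matrix.mul_nonsing_inv _ hpX, Matrix.one_mul,
            Matrix.mul_assoc, Matrix.nonsing_inv_mul _ hmX', Matrix.mul_one]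
      _ = 0 := by rw [hz, Matrix.mul_zero, Matrix.zero_mul]
  exact (sub_eq_zero.1 h3).symm

end Valued

end Literature.NumberTheory.Weil1982.UnitaryFinTopForm
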